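import Summits.QuantumFields.BalabanUV.Beta.D1BFx.RWeightedLegPackSymm
import Summits.QuantumFields.BalabanUV.Beta.D1BFx.TorusAveragingGram

/-!
# `BalabanUV.Beta.D1BFx.TorusBorderedResolventPack` — road «BF-x» for binder row D1, slot (K), `K-ASSEMBLY-SPEC-v2.md` §1 brick 3c (part 3, the
# END of the N-side): **ON EVERY COARSE TORUS `N_T⁻¹` IS THE SORTED PERIODISATION OF THE PACKED `ℤ⁴` N-LEG** —
# `(NT m a p)⁻¹ = blocksHat p (sortK (m+1) (NlegRoad m a))`, MODULO the displayed decay `Spr (Ga (m+1) a)` ONLY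

HONEST FRAMING (cell contract, verbatim): «discharging `BetaPertH` makes Bałaban's UV stability UNCONDITIONAL — a real constructive-QFT
result; it is NOT the continuum limit and NOT the Clay problem.»  HONEST DEPENDENCY (verbatim): «continuum YM on T⁴ ⇐ BetaPertH ∧ nine
spine estimates (0/9 proved); BetaPertH ⇐ (D1) ∧ (D4) ∧ CAP+tail; G-an2-4 gates asym, D1 and NE2/3/4.»  THIS MODULE DISCHARGES NOTHING of
D1 / BetaPertH: [folklore] block-matrix bookkeeping BY NAME over t4-ne9-formalise-leaf-06-g29's `RWeightedLegPack(Symm)` (the packed N-leg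
`NlegK n Ga Cm a′ = pack(½Γ_R, ℋ_R, ℋ♭_R, 2(a′δ − Cm))` as `comp`-words in the constituents `Gp`, `Qp`, `Cp`, their `Spr`, block covariance and
off-lattice zeros), d1-formalise-leaf-03-g8's `SortedRelInv.periodise_sortK_comp` (the sorted product rule), `SortedKernels` (`blocksHat`,
`blocksHat_eq_reindex`, `periodiseF_zero`, `periodiseF_trF`), `TorusCombKKT` (`Qhat`), `TorusAveragingGram.inv_NT_eq_fromBlocks_road`
(the torus N-inverse with both 𝒬-entry letters discharged) and this lineage's `TorusBorderedResolvent` (`NT`, `Ghat`, `Chat`).  No `def`, no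
`def … : Prop`, nothing cited, 0 sorry.  NOT summit progress; NOT BetaPertH, NOT continuum, NOT Clay.

ABSOLUTE RULE (cell, verbatim): «No internally-minted statement may enter as a cited fact. Every hypothesis is either kernel-proved in this
package or a verbatim quotation of a PUBLISHED theorem with page reference. The manuscript(s) under audit are NOT citable for their own
disputed steps — they are the thing under adjudication; programme-internal (2001/route/tribunal) claims are never citable.»

WHY (`HOME/b2b-balaban-beta-d1-p2/K-ASSEMBLY-SPEC-v2.md` §0 DECISION 1, §1 brick 3c).  TB5 reads the N-side one-loop functional on each coarse
torus as `hessT (N_T⁻¹; jets)`; the socket `SortedTraces.tendsto_hessT_sortK_hessKer` needs the leg in the form `(periodiseF p (sortK n A))^`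
for ONE fixed decaying block-covariant packed `ℤ⁴` kernel `A`.  Parts 1–2 + leaf-03's 3b-Q gave `N_T⁻¹` as the explicit block matrix
`[[½(Ĝ − ĜQ̂ᵀĈQ̂Ĝ), ĜQ̂ᵀĈ],[ĈQ̂Ĝ, (2a∕n⁸)1 − 2Ĉ]]`; this file identifies that block matrix with `blocksHat p (sortK n (NlegK …))`, block by block:
each corner of `NlegK` is a `comp`-word in `Gp Ga`, `Qp n`, `Cp n Cm`, whose sorted periodisations are `[[Ĝ,0],[0,0]]`, `[[0,0],[Q̂,0]]`,
`[[0,0],[0,Ĉ]]`, and the sorted product rule multiplies them.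

CONTENT (d = 3, block side `n`, coarse period `p`; generic decaying block-covariant `Ga`, translation-invariant decaying `Cm`; all [folklore]).
* §1 sorted bookkeeping: `blocksHat_sortK_mul` (product rule in `blocksHat` form), `blocksHat_sortK_add`, `blocksHat_sortK_smul`, `blocksHat_sortK_sub`.
* §2 the constituents' corners: `blocksHat_sortK_Gp`, `blocksHat_sortK_Qp`, `blocksHat_sortK_trK_Qp`, `blocksHat_sortK_Cp`.
* §3 the words: `blocksHat_sortK_HRp` (`[[0, ĜQ̂ᵀĈ],[0,0]]`), `blocksHat_sortK_HRbp`, `blocksHat_sortK_sandP`, `blocksHat_sortK_Cp_mass`.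
* §4 **`blocksHat_sortK_NlegK`**: `blocksHat p (sortK n (NlegK n Ga Cm a′)) = fromBlocks (½(Ĝ − ĜQ̂ᵀĈQ̂Ĝ)) (ĜQ̂ᵀĈ) (ĈQ̂Ĝ) ((2a′)•1 − 2Ĉ)`.
* §5 the road: **`inv_NT_eq_blocksHat`**: `(NT m a p)⁻¹ = blocksHat p (sortK (m+1) (NlegRoad m a))`; `NT_mul_blocksHat_NlegRoad`, `blocksHat_NlegRoad_mul_NT`.
Unit `b2b-balaban-beta-d1-p2` (road owner, gen 6).
-/

noncomputable section

namespace Summit.QuantumFields.BalabanUV.Beta.D1BFx.TorusBorderedResolventPack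

open Matrix
open scoped BigOperators
open Literature.Probability.LatticeModels (TorusSite Torus.proj)
open Literature.MathematicalPhysics.QuantumFieldTheory.Balaban1983to89
open Literature.MathematicalPhysics.QuantumFieldTheory.Balaban1983to89.Beta
open ExpKernelCalculus (MKer Decays comp shiftK)
open OneStepResolventKernel (Fib)
open Summit.QuantumFields.BalabanUV.Beta.TameKernelCalculus (Spr trK Spr.trK spr_idK)
open Summit.QuantumFields.BalabanUV.Beta.ChartConjugationRelative (spr_comp)
open Summit.QuantumFields.BalabanUV.Beta.D1BFx.FineHessianLegGrades (spr_add' spr_sub')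
open Summit.QuantumFields.BalabanUV.Beta.BorderedHessian (bhK bhK_inr_row_off)
open Summit.QuantumFields.BalabanUV.Beta.D1BFx.FibredPeriodisation (FKer Kfib Kfib_apply kdeltaF periodiseF periodiseF_apply periodiseF_add
  periodiseF_const_mul periodiseF_kdeltaF_matrix)
open Summit.QuantumFields.BalabanUV.Beta.D1BFx.SortedKernels (fTL fTR fBL fBR trF blocksHat blocksHat_eq_reindex periodiseF_zero periodiseF_trF)
open Summit.QuantumFields.BalabanUV.Beta.D1BFx.SortedReblocking (reblock finePt)
open Summit.QuantumFields.BalabanUV.Beta.D1BFx.SortedPack (ι sortK sortK_inl_inl sortK_inl_inr sortK_inr_inl sortK_inr_inr sortK_trK)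
open Summit.QuantumFields.BalabanUV.Beta.D1BFx.SortedRelInv (periodise_sortK_comp hyp_rows hyp_per)
open Summit.QuantumFields.BalabanUV.Beta.D1BFx.PeriodicArrays (toF)
open Summit.QuantumFields.BalabanUV.Beta.D1BFx.PackedKernelSplit (blk packK)
open Summit.QuantumFields.BalabanUV.Beta.D1BFx.TorusCombKKT (I J Qhat isPeriodic₂_sortK_bhK)
open Summit.QuantumFields.BalabanUV.Beta.D1BFx.CoarseGramInverse (multM spr_multM multM_translate)
open Summit.QuantumFields.BalabanUV.Beta.D1BFx.RWeightedLegPack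
open Summit.QuantumFields.BalabanUV.Beta.D1BFx.TorusBorderedResolvent (Xhat Ghat Chat NT)
open Summit.QuantumFields.BalabanUV.Beta.D1BFx.TorusAveragingGram (inv_NT_eq_fromBlocks_road)

variable {n : ℕ} [NeZero n] {p : ℕ} [NeZero p]

/-! ## §1 Sorted bookkeeping in `blocksHat` form -/

/-- [folklore] **THE SORTED PRODUCT RULE IN BLOCK FORM**: `blocksHat p (sortK n (comp A K)) = blocksHat p (sortK n A) * blocksHat p (sortK n K)`
(leaf-03's `periodise_sortK_comp` re-indexed through `blocksHat_eq_reindex`). -/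
theorem blocksHat_sortK_mul {A K : MKer 4 (Fib 3)} (hA : Spr A) (hK : Spr K)
    (hKc : ∀ t : Fin 4 → ℤ, shiftK ((n : ℤ) • t) K = K) (hKo : ∀ y z f b, Torus.proj n y ≠ 0 → K y z (Sum.inr f) b = 0) :
    blocksHat p (sortK n (comp A K)) = blocksHat p (sortK n A) * blocksHat p (sortK n K) := by
  rw [blocksHat_eq_reindex, blocksHat_eq_reindex, blocksHat_eq_reindex, periodise_sortK_comp (p := p) hA hK hKc hKo,
    Matrix.reindex_apply, Matrix.reindex_apply, Matrix.reindex_apply, Matrix.submatrix_mul_equiv]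

/-- [folklore] Additivity of the sorted periodisation in block form (summable fibres from `Spr`). -/
theorem blocksHat_sortK_add {A B : MKer 4 (Fib 3)} (hA : Spr A) (hB : Spr B) :
    blocksHat p (sortK n (A + B)) = blocksHat p (sortK n A) + blocksHat p (sortK n B) := by
  have hs : sortK n (A + B) = sortK n A + sortK n B := rfl
  have hadd : ∀ i j, periodiseF p (sortK n (A + B)) i j = periodiseF p (sortK n A) i j + periodiseF p (sortK n B) i j := by
    intro i j
    rw [hs]
    exact periodiseF_add (fun a b x => (hyp_rows (n := n) hA a b x).of_abs) (fun a b x => (hyp_rows (n := n) hB a b x).of_abs) i j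
  rw [blocksHat_eq_reindex, blocksHat_eq_reindex, blocksHat_eq_reindex]
  ext i j
  simp only [Matrix.reindex_apply, Matrix.submatrix_apply, Matrix.add_apply, Matrix.of_apply, hadd]

omit [NeZero n] in
/-- [folklore] Homogeneity of the sorted periodisation in block form. -/
theorem blocksHat_sortK_smul (c : ℝ) (A : MKer 4 (Fib 3)) : blocksHat p (sortK n (c • A)) = c • blocksHat p (sortK n A) := by
  have hs : sortK n (c • A) = fun i j => c * sortK n A i j := rfl
  rw [blocksHat_eq_reindex, blocksHat_eq_reindex]
  ext i j
  simp only [Matrix.reindex_apply, Matrix.submatrix_apply, Matrix.smul_apply, Matrix.of_apply, smul_eq_mul, hs,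
    periodiseF_const_mul]

/-- [folklore] Subtraction. -/
theorem blocksHat_sortK_sub {A B : MKer 4 (Fib 3)} (hA : Spr A) (hB : Spr B) :
    blocksHat p (sortK n (A - B)) = blocksHat p (sortK n A) - blocksHat p (sortK n B) := by
  have e : A - B = A + (-1 : ℝ) • B := by
    funext x y a b; simp only [Pi.sub_apply, Pi.add_apply, Pi.smul_apply, smul_eq_mul]; ring
  rw [e, blocksHat_sortK_add hA (spr_smul' (-1) hB), blocksHat_sortK_smul]
  simp only [neg_one_smul, sub_eq_add_neg]

/-! ## §2 The corners of the three constituents -/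

section Corners

variable (n p)
variable (Ga Cm : MKer 4 (Fin 4))

omit [NeZero n] in
/-- [folklore] `blocksHat` unfolded: the four periodised corners. -/
theorem blocksHat_eq (K : FKer 4 ((TorusSite 4 n × Fin 4) ⊕ Fin 4) ((TorusSite 4 n × Fin 4) ⊕ Fin 4)) :
    blocksHat p K = Matrix.fromBlocks (Matrix.of (periodiseF p (fTL K))) (Matrix.of (periodiseF p (fTR K)))
      (Matrix.of (periodiseF p (fBL K))) (Matrix.of (periodiseF p (fBR K))) := rfl

omit [NeZero n] in
/-- [folklore] **THE FINE-LEG PACK**: `blocksHat p (sortK n (Gp Ga)) = [[Ĝ, 0],[0, 0]]`, `Ĝ := (reblock n Ga)^`. -/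
theorem blocksHat_sortK_Gp :
    blocksHat p (sortK n (Gp Ga)) = Matrix.fromBlocks (Matrix.of (periodiseF p (reblock n Ga))) 0 0 0 := by
  have h1 : fTL (sortK n (Gp Ga)) = reblock n Ga := rfl
  have h2 : fTR (sortK n (Gp Ga)) = fun _ _ => (0 : ℝ) := by
    funext ⟨y, z, a⟩ ⟨y', b⟩; simp only [fTR, sortK_inl_inr, Gp_inl_inr]
  have h3 : fBL (sortK n (Gp Ga)) = fun _ _ => (0 : ℝ) := by
    funext ⟨y, a⟩ ⟨y', z', b⟩; simp only [fBL, sortK_inr_inl, Gp_inr_inl]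
  have h4 : fBR (sortK n (Gp Ga)) = fun _ _ => (0 : ℝ) := by
    funext ⟨y, a⟩ ⟨y', b⟩; simp only [fBR, sortK_inr_inr, Gp_inr_inr]
  rw [blocksHat_eq, h1, h2, h3, h4, periodiseF_zero, periodiseF_zero, periodiseF_zero]

/-- [folklore] **THE 𝒬-PACK**: `blocksHat p (sortK n (Qp n)) = [[0, 0],[Q̂, 0]]`, `Q̂ = TorusCombKKT.Qhat n p`. -/
theorem blocksHat_sortK_Qp : blocksHat p (sortK n (Qp n)) = Matrix.fromBlocks 0 0 (Qhat (d := 3) n p) 0 := by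
  have h1 : fTL (sortK n (Qp n)) = fun _ _ => (0 : ℝ) := by
    funext ⟨y, z, a⟩ ⟨y', z', b⟩; simp only [fTL, sortK_inl_inl, Qp_inl_inl]
  have h2 : fTR (sortK n (Qp n)) = fun _ _ => (0 : ℝ) := by
    funext ⟨y, z, a⟩ ⟨y', b⟩; simp only [fTR, sortK_inl_inr, Qp_inl_inr]
  have h3 : fBL (sortK n (Qp n)) = fBL (sortK n (bhK (d := 3) n)) := by
    funext ⟨y, a⟩ ⟨y', z', b⟩; simp only [fBL, sortK_inr_inl, Qp_inr_inl]
  have h4 : fBR (sortK n (Qp n)) = fun _ _ => (0 : ℝ) := by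
    funext ⟨y, a⟩ ⟨y', b⟩; simp only [fBR, sortK_inr_inr, Qp_inr_inr]
  rw [blocksHat_eq, h1, h2, h3, h4, periodiseF_zero, periodiseF_zero, periodiseF_zero]
  rfl

/-- [folklore] **THE 𝒬ᵀ-PACK**: `blocksHat p (sortK n (trK (Qp n))) = [[0, Q̂ᵀ],[0, 0]]` (`periodiseF_trF` on the jointly periodic fibres of `Q`). -/
theorem blocksHat_sortK_trK_Qp : blocksHat p (sortK n (trK (Qp n))) = Matrix.fromBlocks 0 (Qhat (d := 3) n p)ᵀ 0 0 := by
  have ht : sortK n (trK (Qp n)) = trF (sortK n (Qp n)) := sortK_trK _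
  have h1 : fTL (sortK n (trK (Qp n))) = fun _ _ => (0 : ℝ) := by
    funext ⟨y, z, a⟩ ⟨y', z', b⟩; rw [ht]; simp only [fTL, trF, sortK_inl_inl, Qp_inl_inl]
  have h2 : fTR (sortK n (trK (Qp n))) = trF (fBL (sortK n (bhK (d := 3) n))) := by
    funext ⟨y, z, a⟩ ⟨y', b⟩; rw [ht]; simp only [fTR, trF, fBL, sortK_inr_inl, Qp_inr_inl]
  have h3 : fBL (sortK n (trK (Qp n))) = fun _ _ => (0 : ℝ) := by
    funext ⟨y, a⟩ ⟨y', z', b⟩; rw [ht]; simp only [fBL, trF, sortK_inl_inr, Qp_inl_inr]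
  have h4 : fBR (sortK n (trK (Qp n))) = fun _ _ => (0 : ℝ) := by
    funext ⟨y, a⟩ ⟨y', b⟩; rw [ht]; simp only [fBR, trF, sortK_inr_inr, Qp_inr_inr]
  have hper : ∀ (b : Fin 4) (a' : TorusSite 4 n × Fin 4), IsPeriodic₂ p (Kfib (fBL (sortK n (bhK (d := 3) n))) b a') :=
    fun b a' => isPeriodic₂_sortK_bhK n p (Sum.inr b) (Sum.inl a')
  rw [blocksHat_eq, h1, h2, h3, h4, periodiseF_zero, periodiseF_zero, periodiseF_zero, periodiseF_trF hper]
  rfl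

/-- [folklore] The multiplier–multiplier corner of the coarse pack reads the coarse kernel itself: `fBR (sortK n (Cp n Cm)) = toF Cm`. -/
theorem fBR_sortK_Cp : fBR (sortK n (Cp n Cm)) = toF Cm := by
  funext ⟨y, a⟩ ⟨y', b⟩
  simp only [fBR, sortK_inr_inr, Cp_inr_inr, embC_coarse, toF]

/-- [folklore] **THE COARSE PACK**: `blocksHat p (sortK n (Cp n Cm)) = [[0, 0],[0, Ĉm]]`, `Ĉm := (toF Cm)^`. -/
theorem blocksHat_sortK_Cp : blocksHat p (sortK n (Cp n Cm)) = Matrix.fromBlocks 0 0 0 (Matrix.of (periodiseF p (toF Cm))) := by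
  have h1 : fTL (sortK n (Cp n Cm)) = fun _ _ => (0 : ℝ) := by
    funext ⟨y, z, a⟩ ⟨y', z', b⟩; simp only [fTL, sortK_inl_inl, Cp_inl_inl]
  have h2 : fTR (sortK n (Cp n Cm)) = fun _ _ => (0 : ℝ) := by
    funext ⟨y, z, a⟩ ⟨y', b⟩; simp only [fTR, sortK_inl_inr, Cp_inl_inr]
  have h3 : fBL (sortK n (Cp n Cm)) = fun _ _ => (0 : ℝ) := by
    funext ⟨y, a⟩ ⟨y', z', b⟩; simp only [fBL, sortK_inr_inl, Cp_inr_inl]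
  rw [blocksHat_eq, h1, h2, h3, fBR_sortK_Cp, periodiseF_zero, periodiseF_zero, periodiseF_zero]

/-- [folklore] The coarse pack of the identity kernel is the multiplier unit: `blocksHat p (sortK n (Cp n idK)) = [[0,0],[0,1]]`. -/
theorem blocksHat_sortK_Cp_idK :
    blocksHat p (sortK n (Cp n (HessKerSchurResolvent.idK : MKer 4 (Fin 4)))) = Matrix.fromBlocks 0 0 0 1 := by
  rw [blocksHat_sortK_Cp]
  have h : toF (HessKerSchurResolvent.idK : MKer 4 (Fin 4)) = (kdeltaF : FKer 4 (Fin 4) (Fin 4)) := by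
    funext ⟨y, a⟩ ⟨y', b⟩
    simp only [toF, HessKerSchurResolvent.idK_apply, kdeltaF, Prod.mk.injEq]
  rw [h, periodiseF_kdeltaF_matrix]

end Corners

/-! ## §3 The three `comp`-words and the massive corner -/

section Words

variable (n p)
variable {Ga Cm : MKer 4 (Fin 4)}

omit [NeZero n] in
/-- Off-lattice multiplier rows of the 𝒬-pack vanish. -/
theorem Qp_inr_row_off {x : Fin 4 → ℤ} (hx : Torus.proj n x ≠ 0) (y : Fin 4 → ℤ) (m : Fin 4) (b : Fib 3) :
    Qp n x y (Sum.inr m) b = 0 := by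
  cases b with
  | inl b => rw [Qp_inr_inl]; exact bhK_inr_row_off (d := 3) n hx y m (Sum.inl b)
  | inr b => exact Qp_inr_inr n x y m b

omit [NeZero n] in
/-- The 𝒬ᵀ-pack has no multiplier rows at all. -/
theorem trK_Qp_inr_row (x y : Fin 4 → ℤ) (m : Fin 4) (b : Fib 3) : trK (Qp n) x y (Sum.inr m) b = 0 := by
  cases b with
  | inl b => simp only [TameKernelCalculus.trK_apply, Qp_inl_inr]
  | inr b => simp only [TameKernelCalculus.trK_apply, Qp_inr_inr]

/-- The fine pack has no multiplier rows at all. -/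
theorem Gp_inr_row (x y : Fin 4 → ℤ) (m : Fin 4) (b : Fib 3) : Gp Ga x y (Sum.inr m) b = 0 := by
  cases b with
  | inl b => exact Gp_inr_inl Ga x y m b
  | inr b => exact Gp_inr_inr Ga x y m b

omit [NeZero n] in
/-- Off-lattice multiplier rows of the coarse pack vanish. -/
theorem Cp_inr_row_off {x : Fin 4 → ℤ} (hx : Torus.proj n x ≠ 0) (y : Fin 4 → ℤ) (m : Fin 4) (b : Fib 3) :
    Cp n Cm x y (Sum.inr m) b = 0 := by
  cases b with
  | inl b => exact Cp_inr_inl n Cm x y m b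
  | inr b => rw [Cp_inr_inr]; exact embC_row_off n Cm hx y m b

variable (hGa : Spr Ga) (hGac : ∀ t : Fin 4 → ℤ, shiftK ((n : ℤ) • t) Ga = Ga) (hCm : Spr Cm)
  (hCmc : ∀ (y y' v : Fin 4 → ℤ) (m l : Fin 4), Cm (y + v) (y' + v) m l = Cm y y' m l)
include hGa hGac hCm hCmc

omit hGac in
/-- [folklore] **`ℋ_R` ON THE TORUS**: `blocksHat p (sortK n (HRp n Ga Cm)) = [[0, Ĝ·Q̂ᵀ·Ĉm],[0, 0]]`. -/
theorem blocksHat_sortK_HRp :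
    blocksHat p (sortK n (HRp n Ga Cm))
      = Matrix.fromBlocks 0 (Matrix.of (periodiseF p (reblock n Ga)) * (Qhat (d := 3) n p)ᵀ * Matrix.of (periodiseF p (toF Cm))) 0 0 := by
  have hin : Spr (comp (trK (Qp n)) (Cp n Cm)) := spr_comp (spr_Qp n).trK (spr_Cp n hCm)
  have hinc : ∀ t : Fin 4 → ℤ, shiftK ((n : ℤ) • t) (comp (trK (Qp n)) (Cp n Cm)) = comp (trK (Qp n)) (Cp n Cm) := fun t => by
    rw [← ExpKernelCalculus.comp_shiftK, shiftK_trK_Qp n t, shiftK_Cp n hCmc t]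
  have hino : ∀ y z f b, Torus.proj n y ≠ 0 → comp (trK (Qp n)) (Cp n Cm) y z (Sum.inr f) b = 0 :=
    fun y z f b _ => comp_inr_row_off (K := Cp n Cm) (fun w m c => trK_Qp_inr_row n y w m c) z f b
  rw [HRp, blocksHat_sortK_mul (spr_Gp hGa) hin hinc hino, blocksHat_sortK_mul (spr_Qp n).trK (spr_Cp n hCm) (shiftK_Cp n hCmc)
    (fun y z f b hy => Cp_inr_row_off n hy z f b), blocksHat_sortK_Gp, blocksHat_sortK_trK_Qp, blocksHat_sortK_Cp]
  simp only [Matrix.fromBlocks_multiply, Matrix.zero_mul, Matrix.mul_zero, add_zero, zero_add, Matrix.mul_assoc]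

omit hCmc in
/-- [folklore] **`ℋ♭_R` ON THE TORUS**: `blocksHat p (sortK n (HRbp n Ga Cm)) = [[0, 0],[Ĉm·Q̂·Ĝ, 0]]`. -/
theorem blocksHat_sortK_HRbp :
    blocksHat p (sortK n (HRbp n Ga Cm))
      = Matrix.fromBlocks 0 0 (Matrix.of (periodiseF p (toF Cm)) * Qhat (d := 3) n p * Matrix.of (periodiseF p (reblock n Ga))) 0 := by
  have hin : Spr (comp (Qp n) (Gp Ga)) := spr_comp (spr_Qp n) (spr_Gp hGa)
  have hinc : ∀ t : Fin 4 → ℤ, shiftK ((n : ℤ) • t) (comp (Qp n) (Gp Ga)) = comp (Qp n) (Gp Ga) := fun t => by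
    rw [← ExpKernelCalculus.comp_shiftK, shiftK_Qp n t, shiftK_Gp n hGac t]
  have hino : ∀ y z f b, Torus.proj n y ≠ 0 → comp (Qp n) (Gp Ga) y z (Sum.inr f) b = 0 :=
    fun y z f b hy => comp_inr_row_off (K := Gp Ga) (fun w m c => Qp_inr_row_off n hy w m c) z f b
  rw [HRbp, blocksHat_sortK_mul (spr_Cp n hCm) hin hinc hino, blocksHat_sortK_mul (spr_Qp n) (spr_Gp hGa) (shiftK_Gp n hGac)
    (fun y z f b _ => Gp_inr_row y z f b), blocksHat_sortK_Cp, blocksHat_sortK_Qp, blocksHat_sortK_Gp]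
  simp only [Matrix.fromBlocks_multiply, Matrix.zero_mul, Matrix.mul_zero, add_zero, zero_add, Matrix.mul_assoc]

/-- [folklore] **THE SANDWICH ON THE TORUS**: `blocksHat p (sortK n (sandP n Ga Cm)) = [[Ĝ·Q̂ᵀ·Ĉm·Q̂·Ĝ, 0],[0, 0]]`. -/
theorem blocksHat_sortK_sandP :
    blocksHat p (sortK n (sandP n Ga Cm))
      = Matrix.fromBlocks (Matrix.of (periodiseF p (reblock n Ga)) * (Qhat (d := 3) n p)ᵀ * Matrix.of (periodiseF p (toF Cm))
          * Qhat (d := 3) n p * Matrix.of (periodiseF p (reblock n Ga))) 0 0 0 := by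
  have hin : Spr (comp (Qp n) (Gp Ga)) := spr_comp (spr_Qp n) (spr_Gp hGa)
  have hinc : ∀ t : Fin 4 → ℤ, shiftK ((n : ℤ) • t) (comp (Qp n) (Gp Ga)) = comp (Qp n) (Gp Ga) := fun t => by
    rw [← ExpKernelCalculus.comp_shiftK, shiftK_Qp n t, shiftK_Gp n hGac t]
  have hino : ∀ y z f b, Torus.proj n y ≠ 0 → comp (Qp n) (Gp Ga) y z (Sum.inr f) b = 0 :=
    fun y z f b hy => comp_inr_row_off (K := Gp Ga) (fun w m c => Qp_inr_row_off n hy w m c) z f b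
  rw [sandP, blocksHat_sortK_mul (spr_HRp n hGa hCm) hin hinc hino, blocksHat_sortK_mul (spr_Qp n) (spr_Gp hGa) (shiftK_Gp n hGac)
    (fun y z f b _ => Gp_inr_row y z f b), blocksHat_sortK_HRp n p hGa hCm hCmc, blocksHat_sortK_Qp, blocksHat_sortK_Gp]
  simp only [Matrix.fromBlocks_multiply, Matrix.zero_mul, Matrix.mul_zero, add_zero, zero_add, Matrix.mul_assoc]

omit hGa hGac hCmc in
/-- [folklore] **THE MASSIVE CORNER**: `blocksHat p (sortK n (Cp n (a′•idK − Cm))) = [[0,0],[0, a′•1 − Ĉm]]`. -/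
theorem blocksHat_sortK_Cp_mass (a' : ℝ) :
    blocksHat p (sortK n (Cp n (a' • HessKerSchurResolvent.idK - Cm)))
      = Matrix.fromBlocks 0 0 0 (a' • (1 : Matrix (J 3 p) (J 3 p) ℝ) - Matrix.of (periodiseF p (toF Cm))) := by
  rw [Cp_sub, Cp_smul, blocksHat_sortK_sub (spr_smul' a' (spr_Cp n spr_idK)) (spr_Cp n hCm), blocksHat_sortK_smul,
    blocksHat_sortK_Cp_idK, blocksHat_sortK_Cp]
  ext i j
  rcases i with i | i <;> rcases j with j | j <;>
    simp only [Matrix.sub_apply, Matrix.smul_apply, Matrix.fromBlocks_apply₁₁, Matrix.fromBlocks_apply₁₂, Matrix.fromBlocks_apply₂₁,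
      Matrix.fromBlocks_apply₂₂, Matrix.zero_apply, smul_zero, sub_zero]

end Words

/-! ## §4 The packed N-leg on the torus -/

section Leg

variable (n p)
variable {Ga Cm : MKer 4 (Fin 4)}

/-- [folklore] **THE PACKED N-LEG ON THE TORUS**: for a decaying block-covariant fine leg `Ga` and a decaying translation-invariant coarse kernel `Cm`,
`blocksHat p (sortK n (NlegK n Ga Cm a′)) = [[½(Ĝ − ĜQ̂ᵀĈQ̂Ĝ), ĜQ̂ᵀĈ],[ĈQ̂Ĝ, (2a′)•1 − 2Ĉ]]`, `Ĝ := (reblock n Ga)^`, `Q̂ := Qhat n p`, `Ĉ := (toF Cm)^`. -/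
theorem blocksHat_sortK_NlegK (hGa : Spr Ga) (hGac : ∀ t : Fin 4 → ℤ, shiftK ((n : ℤ) • t) Ga = Ga) (hCm : Spr Cm)
    (hCmc : ∀ (y y' v : Fin 4 → ℤ) (m l : Fin 4), Cm (y + v) (y' + v) m l = Cm y y' m l) (a' : ℝ) :
    blocksHat p (sortK n (NlegK n Ga Cm a'))
      = Matrix.fromBlocks
          ((1 / 2 : ℝ) • (Matrix.of (periodiseF p (reblock n Ga))
              - Matrix.of (periodiseF p (reblock n Ga)) * (Qhat (d := 3) n p)ᵀ * Matrix.of (periodiseF p (toF Cm)) * Qhat (d := 3) n p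
                  * Matrix.of (periodiseF p (reblock n Ga))))
          (Matrix.of (periodiseF p (reblock n Ga)) * (Qhat (d := 3) n p)ᵀ * Matrix.of (periodiseF p (toF Cm)))
          (Matrix.of (periodiseF p (toF Cm)) * Qhat (d := 3) n p * Matrix.of (periodiseF p (reblock n Ga)))
          ((2 * a') • (1 : Matrix (J 3 p) (J 3 p) ℝ) - (2 : ℝ) • Matrix.of (periodiseF p (toF Cm))) := by
  have hGp := spr_Gp hGa
  have hsand := spr_sandP n hGa hCm
  have hHR := spr_HRp n hGa hCm
  have hHRb := spr_HRbp n hGa hCm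
  have hCp2 : Spr (Cp n (a' • HessKerSchurResolvent.idK - Cm)) := by
    rw [Cp_sub, Cp_smul]; exact spr_sub' (spr_smul' a' (spr_Cp n spr_idK)) (spr_Cp n hCm)
  rw [NlegK, blocksHat_sortK_add (spr_add' (spr_add' (spr_smul' _ (spr_sub' hGp hsand)) hHR) hHRb) (spr_smul' _ hCp2),
    blocksHat_sortK_add (spr_add' (spr_smul' _ (spr_sub' hGp hsand)) hHR) hHRb, blocksHat_sortK_add (spr_smul' _ (spr_sub' hGp hsand)) hHR,
    blocksHat_sortK_smul, blocksHat_sortK_smul, blocksHat_sortK_sub hGp hsand, blocksHat_sortK_Gp, blocksHat_sortK_sandP n p hGa hGac hCm hCmc,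
    blocksHat_sortK_HRp n p hGa hCm hCmc, blocksHat_sortK_HRbp n p hGa hGac hCm, blocksHat_sortK_Cp_mass n p hCm a']
  ext i j
  rcases i with i | i <;> rcases j with j | j <;>
    simp only [Matrix.add_apply, Matrix.sub_apply, Matrix.smul_apply, Matrix.fromBlocks_apply₁₁, Matrix.fromBlocks_apply₁₂,
      Matrix.fromBlocks_apply₂₁, Matrix.fromBlocks_apply₂₂, Matrix.zero_apply, Matrix.one_apply, smul_eq_mul, mul_zero, add_zero,
      zero_add, sub_zero, smul_sub, mul_sub] <;> ring

end Leg

/-! ## §5 The road: `N_T⁻¹` is the sorted periodisation of `NlegRoad` -/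

section Road

/-- [folklore] **`(NT m a q)⁻¹ = blocksHat q (sortK (m+1) (NlegRoad m a))`** — on every coarse torus the inverse of the R-weighted bordered system IS the
sorted periodisation of t4-ne9-formalise-leaf-06-g29's packed `ℤ⁴` N-leg, MODULO the displayed decay `Spr (Ga (m+1) a)` (printed [B5, Prop. 1.2] ∧
[B5, (1.126)–(1.127)]) only; the three torus letters of part 1 are all discharged (`Xhat_mul_Ghat`, leaf-03-g8's `Xhat_eq_add_smul` ∕
`Qhat_mul_Ghat_mul_QhatT_road`). -/
theorem inv_NT_eq_blocksHat (m : ℕ) {a : ℝ} (ha : 0 < a) (hGa : Spr (GluonLeg.Ga (m + 1) a)) (q : ℕ) [NeZero q] :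
    (NT m a q)⁻¹ = blocksHat q (sortK (m + 1) (NlegRoad m a)) := by
  have hn : 1 ≤ m + 1 := Nat.le_add_left 1 m
  rw [inv_NT_eq_fromBlocks_road m ha hGa q, NlegRoad,
    blocksHat_sortK_NlegK (m + 1) q hGa (fun t => GluonLeg.shiftK_Ga (m + 1) a hn t) (spr_multM (m + 1) _ _)
      (fun y y' v m' l => multM_translate (m + 1) _ _ y y' v m' l) (a / ((m + 1 : ℕ) : ℝ) ^ 8)]
  have e2 : (2 : ℝ) * (a / ((m + 1 : ℕ) : ℝ) ^ 8) = 2 * a / ((m + 1 : ℕ) : ℝ) ^ 8 := by ring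
  rw [e2]
  rfl

/-- [folklore] Right-inverse form: `NT m a q * blocksHat q (sortK (m+1) (NlegRoad m a)) = 1`. -/
theorem NT_mul_blocksHat_NlegRoad (m : ℕ) {a : ℝ} (ha : 0 < a) (hGa : Spr (GluonLeg.Ga (m + 1) a)) (q : ℕ) [NeZero q] :
    NT m a q * blocksHat q (sortK (m + 1) (NlegRoad m a)) = 1 := by
  rw [← inv_NT_eq_blocksHat m ha hGa q]
  exact Matrix.mul_nonsing_inv _ (TorusAveragingGram.isUnit_det_NT_road m ha hGa q)

/-- [folklore] Left-inverse form: `blocksHat q (sortK (m+1) (NlegRoad m a)) * NT m a q = 1`. -/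
theorem blocksHat_NlegRoad_mul_NT (m : ℕ) {a : ℝ} (ha : 0 < a) (hGa : Spr (GluonLeg.Ga (m + 1) a)) (q : ℕ) [NeZero q] :
    blocksHat q (sortK (m + 1) (NlegRoad m a)) * NT m a q = 1 := by
  rw [← inv_NT_eq_blocksHat m ha hGa q]
  exact Matrix.nonsing_inv_mul _ (TorusAveragingGram.isUnit_det_NT_road m ha hGa q)

end Road

end Summit.QuantumFields.BalabanUV.Beta.D1BFx.TorusBorderedResolventPack

end
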